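import Summits.CriticalPhenomena.SAWScalingLimit.Theses.SAWRenewalTightness
import Summits.CriticalPhenomena.SAWScalingLimit.Theorems.SAWRenewalTightnessShellCrossingBoundSplit
import Summits.CriticalPhenomena.SAWScalingLimit.Theorems.SAWRenewalTightnessTightOfShellCrossing
import HarnessLib

/-!
# `EventualTightOfSubs` — the glue item of the split `EventualTight ⟸ ConfinementPositivity ∧ BulkShellTight`

Closes the support item `stmt-CriticalPhenomena-17589` (`SAWRenewalTightness.EventualTightOfSubs :=
ConfinementPositivity → BulkShellTight → EventualTight`, route rev 2) by composing the two LANDED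
theorems `Theorems.ShellCrossingBound_of_subs` (p138355: restriction positivity + interior-shell count
tightness ⇒ the Aizenman–Burchard shell bound, via a good middle circle, a socketed enlargement, a
finite net and restriction covariance) and `Theorems.TightOfShellCrossing_proof` (stmt-4732: the AB
criterion with shell-dependent threshold).  The child decls `ConfinementPositivity`, `BulkShellTight`
of the route file are, verbatim, the two hypotheses of `ShellCrossingBound_of_subs`, so the term
elaborates by unfolding.  Folklore composition; no named fact.
[cite: AizenmanBurchardDuke1999, Thm 1.1 and §1.b] [cite: LawlerSchrammWerner2004SAW, §3]
-/

namespace Summit.CriticalPhenomena.SAWScalingLimit.Theorems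

open Summit.CriticalPhenomena.SAWScalingLimit.Theses.SAWRenewalTightness

/-- **Glue of the split of `EventualTight` (stmt-CriticalPhenomena-17589):** restriction positivity and
bulk per-shell count tightness give eventual tightness of the critical `ℤ²` SAW laws —
`TightOfShellCrossing_proof ∘ ShellCrossingBound_of_subs`. [cite: AizenmanBurchardDuke1999, Thm 1.1] -/
theorem eventualTightOfSubs_proof : EventualTightOfSubs :=
  fun hE hB => TightOfShellCrossing_proof (ShellCrossingBound_of_subs hE hB)

end Summit.CriticalPhenomena.SAWScalingLimit.Theorems
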